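import Summits.BirchSwinnertonDyer.BirchSwinnertonDyer.Theorems.PlecticLegsArtinBaseChangeEulerLemmas
import Summits.BirchSwinnertonDyer.BirchSwinnertonDyer.Theorems.PlecticLegsArtinBaseChangeLocal
import Summits.BirchSwinnertonDyer.BirchSwinnertonDyer.Theorems.PlecticLegsArtinBaseChangeCharacters
import Summits.BirchSwinnertonDyer.BirchSwinnertonDyer.Theorems.PlecticLegsArtinBaseChangePlaces

/-!
# The local Artin identity at a place `p ∤ m` for `F = ℚ(ζ_m)^H`

Route `PlecticLegs`, support item `ArtinBaseChange` (stmt-BirchSwinnertonDyer-18261). For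
`F = ℚ(ζ_m)^H` with character group `Y_H` and a finite place `v` of `ℚ` with `p = N v ∤ m`, the
product over the places `w ∣ v` of `F` of the local Euler factors of `E_F` is the product over
`χ ∈ Y_H` of the `χ`-twists of the local Euler factor of `E` at `v`
(`intCoe_finprod_localEulerFactor_baseChange_fixedField`): `L_w(E_F) = N_f L_v(E)` at the
`#(Gal/H)/f` places `w ∣ v`, all unramified of residue degree `f = ord(σ_p H)`
(`PlecticLegsArtinBaseChangeLocal`, `…Places`), against the character product lemma
(`…Characters`). This is Artin formalism `L(E/F, s) = ∏_χ L(E, χ, s)` one unramified prime at a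
time (Ireland–Rosen Prop. 20.5.4 for the quadratic case).
-/

noncomputable section

-- D-0017: single-problem summit, so `Summit.BirchSwinnertonDyer.BirchSwinnertonDyer.…` repeats a
-- namespace BY DESIGN.
set_option linter.dupNamespace false

open scoped Classical
open Filter ArithmeticFunction

namespace Summit.BirchSwinnertonDyer.BirchSwinnertonDyer.Theorems

/-! ## The local Artin identity at a place `v ∤ m` -/

section LocalIdentity

open NumberField IsDedekindDomain WeierstrassCurve Polynomial IsCyclotomicExtension.Rat
  Literature.NumberTheory.EllipticCurves Literature.NumberTheory.GaloisRepresentations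

/-- **The residue cardinality of a finite place of `ℚ` is the prime below it**: `N v` is prime and
lies in `v`. [folklore] -/
theorem residueCard_rat (v : HeightOneSpectrum (𝓞 ℚ)) :
    v.residueCard.Prime ∧ (v.residueCard : 𝓞 ℚ) ∈ v.asIdeal := by
  refine ⟨?_, by exact_mod_cast Ideal.absNorm_mem v.asIdeal⟩
  rw [v.residueCard_eq_card_quotient]
  have h : Ideal.span {(Rat.HeightOneSpectrum.natGenerator v : ℤ)} =
      v.asIdeal.map (Rat.IsIntegralClosure.intEquiv (𝓞 ℚ) : 𝓞 ℚ →+* ℤ) :=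
    Rat.HeightOneSpectrum.span_natGenerator v
  rw [Nat.card_congr ((Ideal.quotientEquiv _ _ (Rat.IsIntegralClosure.intEquiv (𝓞 ℚ)) h).trans
    (Int.quotientSpanNatEquivZMod _)).toEquiv, Nat.card_zmod]
  exact Rat.HeightOneSpectrum.prime_natGenerator v

/-- Over `ℂ` every pair (sum, product) is realised by two numbers: `∃ α β, α + β = t ∧ αβ = δ`
(a root of `X² - tX + δ`). [folklore] -/
theorem exists_add_eq_and_mul_eq (t δ : ℂ) : ∃ α β : ℂ, α + β = t ∧ α * β = δ := by
  obtain ⟨s, hs⟩ := IsAlgClosed.exists_pow_nat_eq (t ^ 2 - 4 * δ) two_pos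
  exact ⟨(t + s) / 2, (t - s) / 2, by ring, by linear_combination (-1 / 4 : ℂ) * hs⟩

/-- The rescaling of the quadratic `1 - tX + δX²` by `c` is `1 - tcX + δc²X²` (as power series).
[folklore] -/
theorem rescale_coe_quadratic (t δ c : ℂ) :
    PowerSeries.rescale c ((1 - C t * X + C δ * X ^ 2 : ℂ[X]) : PowerSeries ℂ) =
      ((1 - C (t * c) * X + C (δ * c ^ 2) * X ^ 2 : ℂ[X]) : PowerSeries ℂ) := by
  ext k
  rw [PowerSeries.coeff_rescale, Polynomial.coeff_coe, Polynomial.coeff_coe]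
  simp only [coeff_add, coeff_sub, coeff_one, coeff_C_mul, coeff_X_pow, coeff_X]
  rcases k with _ | _ | _ | k
  · simp
  · simp; ring
  · simp; ring
  · simp

/-- **The character side, as a polynomial identity.** With `n = ord(σ_u H)`, `g = #(Gal/H)/n` and
`α + β = t`, `αβ = δ`:
`∏_{χ ∈ Y_H} (1 - tχ(u) X + δχ(u)² X²) = (1 - (α^n + β^n) X^n + δ^n X^{2n})^g` in `ℂ[X]` — both
sides agree at every `y ∈ ℂ` by the character product lemma
(`prod_one_sub_apply_mul_eq_of_subgroupChar`) applied to `T = αy` and `T = βy`. [folklore] -/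
theorem prod_quadratic_twist_eq_pow {m : ℕ} [NeZero m] (K : Type) [Field K] [NumberField K]
    [IsCyclotomicExtension {m} ℚ K] [IsMulCommutative Gal(K/ℚ)] (H : Subgroup Gal(K/ℚ))
    (u : (ZMod m)ˣ) {t δ α β : ℂ} (h1 : α + β = t) (h2 : α * β = δ) :
    ∏ χ ∈ Finset.univ.filter (fun χ : DirichletCharacter ℂ m ↦
        χ ∈ (subgroupGalEquivSubgroupChar m K ℂ H).ofDual),
      (1 - C (t * χ u) * X + C (δ * χ u ^ 2) * X ^ 2 : ℂ[X]) =
      (1 - C ((dickson 1 δ (orderOf (QuotientGroup.mk ((galEquivZMod m K).symm u) :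
          Gal(K/ℚ) ⧸ H))).eval t) *
          X ^ orderOf (QuotientGroup.mk ((galEquivZMod m K).symm u) : Gal(K/ℚ) ⧸ H) +
        C (δ ^ orderOf (QuotientGroup.mk ((galEquivZMod m K).symm u) : Gal(K/ℚ) ⧸ H)) *
          X ^ (2 * orderOf (QuotientGroup.mk ((galEquivZMod m K).symm u) : Gal(K/ℚ) ⧸ H))) ^
        (Nat.card (Gal(K/ℚ) ⧸ H) /
          orderOf (QuotientGroup.mk ((galEquivZMod m K).symm u) : Gal(K/ℚ) ⧸ H)) := by
  set n := orderOf (QuotientGroup.mk ((galEquivZMod m K).symm u) : Gal(K/ℚ) ⧸ H) with hn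
  set g := Nat.card (Gal(K/ℚ) ⧸ H) / n with hg
  refine Polynomial.funext fun y ↦ ?_
  rw [eval_prod, eval_pow]
  have hfac : ∀ χ : DirichletCharacter ℂ m,
      eval y (1 - C (t * χ u) * X + C (δ * χ u ^ 2) * X ^ 2 : ℂ[X]) =
        (1 - χ u * (α * y)) * (1 - χ u * (β * y)) := by
    intro χ
    simp only [eval_add, eval_sub, eval_one, eval_mul, eval_C, eval_X, eval_pow]
    rw [← h1, ← h2]
    ring
  simp_rw [hfac]
  rw [Finset.prod_mul_distrib, prod_one_sub_apply_mul_eq_of_subgroupChar m K H u (α * y),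
    prod_one_sub_apply_mul_eq_of_subgroupChar m K H u (β * y), ← hn, ← hg, ← mul_pow]
  congr 1
  simp only [eval_add, eval_sub, eval_one, eval_mul, eval_C, eval_X, eval_pow]
  rw [← pow_add_pow_eq_dickson_eval h1 h2 n, ← h2]
  ring

variable (W : WeierstrassCurve ℚ) [W.IsElliptic] (m : ℕ) [NeZero m] (K : Type) [Field K]
  [NumberField K] [IsCyclotomicExtension {m} ℚ K] [IsGalois ℚ K] [IsMulCommutative Gal(K/ℚ)]
  (H : Subgroup Gal(K/ℚ))

set_option maxHeartbeats 800000 in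
/-- **The local Artin identity at `v ∤ m`.** Let `F = ℚ(ζ_m)^H`, `Y_H` its character group and `v`
a finite place of `ℚ` with `m ∉ v` (`p = N v ∤ m`). Then the product over the places `w ∣ v` of `F`
of the local Euler factors of `E_F` is the product over `χ ∈ Y_H` of the `χ`-twists of the local
Euler factor of `E` at `v`:
`∏_{w ∣ v} L_w(E_F, N w^{-s})⁻¹ = ∏_{χ ∈ Y_H} L_v(E, χ(p) p^{-s})⁻¹`.
Proof: every `w ∣ v` is unramified of residue degree `n = ord(σ_p H)` (`PlecticLegsArtinBaseChangePlaces`),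
so `L_w(E_F, T) = N_n L_v(E, T)` (`localPolynomialAt_baseChange_of_ramificationIdx_eq_one`) and
`N w = p^n`; there are `#(Gal/H)/n` such `w`; and
`∏_χ L_v(E, χ(p) T) = (N_n L_v)(T^n)^{#(Gal/H)/n}` (`prod_quadratic_twist_eq_pow`). This is Artin
formalism `L(E/F, s) = ∏_χ L(E, χ, s)` one unramified prime at a time (Ireland–Rosen Prop. 20.5.4
for `[F : ℚ] = 2`). [folklore] -/
theorem intCoe_finprod_localEulerFactor_baseChange_fixedField (v : HeightOneSpectrum (𝓞 ℚ))
    (hmv : (m : 𝓞 ℚ) ∉ v.asIdeal) :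
    ((∏ᶠ w ∈ {w : HeightOneSpectrum (𝓞 ↥(IntermediateField.fixedField H)) |
        w.under (𝓞 ℚ) = v},
        (((W.baseChange ↥(IntermediateField.fixedField H)).baseChange
          (w.adicCompletion ↥(IntermediateField.fixedField H))).localEulerFactor
            (w.adicCompletionIntegers ↥(IntermediateField.fixedField H)) :
          ArithmeticFunction ℤ) : ArithmeticFunction ℤ) : ArithmeticFunction ℂ) =
      ∏ χ ∈ Finset.univ.filter (fun χ : DirichletCharacter ℂ m ↦
          χ ∈ (subgroupGalEquivSubgroupChar m K ℂ H).ofDual),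
        (toArithmeticFunction (fun k : ℕ ↦ χ (k : ZMod m))).pmul
          (((W.baseChange (v.adicCompletion ℚ)).localEulerFactor (v.adicCompletionIntegers ℚ) :
            ArithmeticFunction ℤ) : ArithmeticFunction ℂ) := by
  haveI : IsGalois ℚ ↥(IntermediateField.fixedField H) := IsGalois.of_fixedField_normal_subgroup H
  -- the prime `p` below `v`
  obtain ⟨hp, hpv⟩ := residueCard_rat v
  set p := v.residueCard with hpdef
  haveI : Fact p.Prime := ⟨hp⟩
  have hp1 : 1 < p := hp.one_lt
  have hpm : ¬ p ∣ m := by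
    rintro ⟨k, hk⟩
    apply hmv
    rw [hk, Nat.cast_mul]
    exact v.asIdeal.mul_mem_right _ hpv
  set σ : Gal(K/ℚ) := (galEquivZMod m K).symm (ZMod.unitOfCoprime p (hp.coprime_iff_not_dvd.mpr hpm))
    with hσ
  set n := orderOf (QuotientGroup.mk σ : Gal(K/ℚ) ⧸ H) with hndef
  have hn : 0 < n := orderOf_pos _
  -- the local polynomial at `v`
  obtain ⟨t, δ, hL⟩ := exists_localPolynomial_eq (v.adicCompletionIntegers ℚ)
    (W.baseChange (v.adicCompletion ℚ))
  have hLv : W.localPolynomialAt v = 1 - C t * X + C δ * X ^ 2 := hL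
  -- the places `w ∣ v`: unramified, residue degree `n`, common local polynomial `Ln`
  set T := {w : HeightOneSpectrum (𝓞 ↥(IntermediateField.fixedField H)) | w.under (𝓞 ℚ) = v}
    with hTdef
  have hT : T.Finite := v.finite_setOf_under_eq_of_numberField
  set Ln : ℤ[X] := 1 - C ((dickson 1 δ n).eval t) * X + C (δ ^ n) * X ^ 2 with hLn
  have hLn0 : Ln.coeff 0 = 1 := by simp [hLn]
  have hw : ∀ w ∈ T, (W.baseChange ↥(IntermediateField.fixedField H)).localPolynomialAt w = Ln ∧
      w.residueCard = p ^ n := by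
    intro w hwT
    have hw' : w.asIdeal.under (𝓞 ℚ) = v.asIdeal := congrArg HeightOneSpectrum.asIdeal hwT
    obtain ⟨he, hf⟩ := ramificationIdx_eq_one_and_inertiaDeg_eq_orderOf' m K p H hpm hpv w hw'
    refine ⟨?_, ?_⟩
    · rw [hLn, hndef, hσ, ← hf]
      exact localPolynomialAt_baseChange_of_ramificationIdx_eq_one W
        ↥(IntermediateField.fixedField H) hw' he hLv
    · rw [residueCard_eq_residueCard_pow_inertiaDeg hw', hf]
  -- the left-hand side: `g` equal factors
  have hfac : ∀ w ∈ T, ((W.baseChange ↥(IntermediateField.fixedField H)).baseChange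
      (w.adicCompletion ↥(IntermediateField.fixedField H))).localEulerFactor
        (w.adicCompletionIntegers ↥(IntermediateField.fixedField H)) =
      ofPowerSeries p (PowerSeries.invOfUnit ((expand ℤ n Ln : ℤ[X]) : PowerSeries ℤ) 1) := by
    intro w hwT
    obtain ⟨hLw, hqw⟩ := hw w hwT
    rw [(W.baseChange ↥(IntermediateField.fixedField H)).localEulerFactor_baseChange_adicCompletion w,
      hLw, hqw, ofPowerSeries_pow _ hn.ne', PowerSeries.subst_X_pow_invOfUnit_coe hn.ne' _ hLn0]
  have hg : T.ncard * n = Nat.card (Gal(K/ℚ) ⧸ H) := by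
    have h := ncard_setOf_under_eq_mul_orderOf m K p H hpm hpv
    rw [← hσ, ← hndef] at h
    convert h using 3
    ext w
    simp only [hTdef, Set.mem_setOf_eq, HeightOneSpectrum.ext_iff]
    rfl
  have hgdiv : Nat.card (Gal(K/ℚ) ⧸ H) / n = T.ncard := by
    rw [← hg, Nat.mul_div_cancel _ hn]
  have hLHS : ∏ᶠ w ∈ T, ((W.baseChange ↥(IntermediateField.fixedField H)).baseChange
      (w.adicCompletion ↥(IntermediateField.fixedField H))).localEulerFactor
        (w.adicCompletionIntegers ↥(IntermediateField.fixedField H)) =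
      ofPowerSeries p (PowerSeries.invOfUnit (((expand ℤ n Ln : ℤ[X]) : PowerSeries ℤ) ^ T.ncard) 1) := by
    rw [finprod_mem_eq_finite_toFinset_prod _ hT, Finset.prod_congr rfl fun w hw ↦
      hfac w (hT.mem_toFinset.mp hw), Finset.prod_const, ← Set.ncard_eq_toFinset_card T hT,
      ← map_pow, invOfUnit_one_pow]
    rw [Polynomial.constantCoeff_coe, Polynomial.coeff_expand hn, if_pos (dvd_zero n), Nat.zero_div,
      hLn0]
  rw [hLHS, intCoe_ofPowerSeries hp1, map_invOfUnit_one _ (by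
    rw [map_pow, Polynomial.constantCoeff_coe, Polynomial.coeff_expand hn, if_pos (dvd_zero n),
      Nat.zero_div, hLn0, one_pow])]
  -- the right-hand side
  have hLvC : PowerSeries.constantCoeff (((W.localPolynomialAt v).map (Int.castRingHom ℂ) : ℂ[X]) :
      PowerSeries ℂ) = 1 := by
    rw [Polynomial.constantCoeff_coe, Polynomial.coeff_map, W.coeff_zero_localPolynomialAt v, map_one]
  have hRHS : ∀ χ : DirichletCharacter ℂ m,
      (toArithmeticFunction (fun k : ℕ ↦ χ (k : ZMod m))).pmul
        (((W.baseChange (v.adicCompletion ℚ)).localEulerFactor (v.adicCompletionIntegers ℚ) :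
          ArithmeticFunction ℤ) : ArithmeticFunction ℂ) =
      ofPowerSeries p (PowerSeries.invOfUnit ((1 - C ((t : ℂ) * χ (p : ZMod m)) * X +
        C ((δ : ℂ) * χ (p : ZMod m) ^ 2) * X ^ 2 : ℂ[X]) : PowerSeries ℂ) 1) := by
    intro χ
    rw [W.localEulerFactor_baseChange_adicCompletion v, intCoe_ofPowerSeries hp1,
      map_invOfUnit_one _ (by rw [Polynomial.constantCoeff_coe, W.coeff_zero_localPolynomialAt v]),
      ← Polynomial.polynomial_map_coe, twist_ofPowerSeries χ hp1, rescale_invOfUnit_one _ hLvC,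
      hLv]
    congr 2
    have : ((1 - C t * X + C δ * X ^ 2 : ℤ[X]).map (Int.castRingHom ℂ)) =
        (1 - C (t : ℂ) * X + C (δ : ℂ) * X ^ 2 : ℂ[X]) := by
      simp [Polynomial.map_sub, Polynomial.map_mul]
    rw [this, rescale_coe_quadratic]
  rw [Finset.prod_congr rfl fun χ _ ↦ hRHS χ, ← map_prod, ← invOfUnit_one_finset_prod _ _ (fun χ _ ↦ by
    rw [Polynomial.constantCoeff_coe]; simp)]
  congr 2
  -- the polynomial identity
  obtain ⟨α, β, h1, h2⟩ := exists_add_eq_and_mul_eq (t : ℂ) (δ : ℂ)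
  have key := prod_quadratic_twist_eq_pow K H (ZMod.unitOfCoprime p (hp.coprime_iff_not_dvd.mpr hpm))
    h1 h2
  simp only [ZMod.coe_unitOfCoprime] at key
  rw [← hσ, ← hndef, hgdiv] at key
  have hcast : (((dickson 1 δ n).eval t : ℤ) : ℂ) = (dickson 1 (δ : ℂ) n).eval (t : ℂ) := by
    have h := map_dickson_eval (Int.castRingHom ℂ) t δ n
    simpa only [eq_intCast] using h
  have hpoly : (expand ℤ n Ln ^ T.ncard).map (Int.castRingHom ℂ) =
      ∏ χ ∈ Finset.univ.filter (fun χ : DirichletCharacter ℂ m ↦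
          χ ∈ (subgroupGalEquivSubgroupChar m K ℂ H).ofDual),
        (1 - C ((t : ℂ) * χ (p : ZMod m)) * X + C ((δ : ℂ) * χ (p : ZMod m) ^ 2) * X ^ 2 : ℂ[X]) := by
    rw [key, Polynomial.map_pow, Polynomial.map_expand, hLn]
    simp only [Polynomial.map_sub, Polynomial.map_add, Polynomial.map_one, Polynomial.map_mul,
      Polynomial.map_pow, map_C, map_X]
    simp only [eq_intCast, hcast, map_sub, map_add, map_one, map_mul, map_pow, expand_C, expand_X]
    ring
  rw [← Polynomial.coe_pow, ← Polynomial.polynomial_map_coe, hpoly]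
  exact map_prod Polynomial.coeToPowerSeries.ringHom _ _

end LocalIdentity

end Summit.BirchSwinnertonDyer.BirchSwinnertonDyer.Theorems

end
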